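import Summits.RiemannHypothesis.RiemannHypothesis.Theorems.HandoffDodgerSmallHorizon
import HarnessLib

/-!
# HANDOFF — RATE 7/100 FROM 10⁴ (1): the horizon inequalities for EVERY `b ≥ 23/5` (rh-explicit, W-P(P1)/(P2) item 19394 `DodgerFamilyFromTenThousand`, seat dodger-p2 gen2)

RH-FREE. HONEST FRAMING: nothing here bears on the truth of RH; elementary real analysis (Mathlib + the `b`-generic definitions
`dodgerT₀`, `dodgerTstar`, `dodgerKprime`, `dodgerTprime`, `dodgerCI`, `dodgerW`, `dodgerPL`, `dodgerPU` of the gen10 files). This is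
part (1) of the discharge of the hypotheses of `HandoffDodgerExplicitWindowCounting.dodger_witness_explicit_window_counting` (the
explicit mollified zero-dodger witness with a free collar window and ATTEMPT-16's COUNTING profile control) at the UNIFORM schedule
`y = (23/25)L^{3/2}`, `N₁ = ⌈(16/5)L⌉`, `α = 12/25`, `n = q³`, rate `C = 7/100`, `b = L/2 − ε`, for EVERY `L = log q ≥ log 10⁴`, i.e. every
`b ≥ 23/5`, towards the WEIL route's item `DodgerFamilyFromTenThousand = SubwindowZeroSumFamily (7/100) 10000` (the RH-free zero-sum
family at the printed rate `(7/100)(log q)^{3/2}q^{−3/2}`, proved in the tree from `⌈e^{204}⌉` at rate 7/100 and from `60000` at rate 1/5).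
This file: the sizes of `T₀ = 2πe^{1+2b}`, `s₁(T₀)`, `T*`, `k′`, `T′ = πk′/b`, `W`, `cI`, `pL`, `pU` with constants that are SHARP at
the floor and UNIFORM above it (`17.06e^{2b} ≤ T′`, `T₀ ≤ 1.0011T′`, `T′³/56.8 ≤ cI ≤ T′³/56.548`, `T′³/28.42 ≤ pL`, `pU ≤ 0.3184·b·T′³`,
`k′ ≤ 0.31831·b·T′`, `7900b² ≤ T′`, `36000b ≤ T′`), from the numerical floor `e^{46/5} ≥ 9885` and `e^{2b} ≥ 9885(1 + t + t²/2)`,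
`t = 2b − 46/5`. gen11's `HandoffDodgerSmallHorizon` (every `b ≥ 11/2`, cruder constants) and this seat's gen0 slab files (bounded `b`)
are the templates. No `sorry`, standard axioms.

References: this track (ATTEMPT-16 §1, ATTEMPT-19 §8, ATTEMPT-21 §2, ATTEMPT-23 §7; HOME/rh-explicit-dodger-p2/DODGER-STAGE2-PLAN.md).
-/

set_option linter.dupNamespace false

noncomputable section

open Real

namespace Summit.RiemannHypothesis.RiemannHypothesis.Theorems.Handoff

/-! ## Numerical floor -/

/-- `9885 ≤ e^{46/5}`. [folklore] -/
theorem exp_nine_point_two_ge : (9885 : ℝ) ≤ Real.exp (46 / 5) := by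
  have hgt := Real.exp_one_gt_d9
  have h9e : Real.exp 1 ^ 9 = Real.exp 9 := by exact_mod_cast Real.exp_one_pow 9
  have e1 : Real.exp (46 / 5) = Real.exp 1 ^ 9 * Real.exp (1 / 5) := by
    rw [h9e, ← Real.exp_add]; norm_num
  have h10 : (2.7182818283 : ℝ) ^ 9 ≤ Real.exp 1 ^ 9 := pow_le_pow_left₀ (by norm_num) hgt.le 9
  have h3 : (1.22 : ℝ) ≤ Real.exp (1 / 5) := by
    have := Real.quadratic_le_exp_of_nonneg (show (0 : ℝ) ≤ 1 / 5 by norm_num); norm_num at this; linarith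
  rw [e1]
  calc (9885 : ℝ) ≤ 2.7182818283 ^ 9 * 1.22 := by norm_num
    _ ≤ Real.exp 1 ^ 9 * Real.exp (1 / 5) := mul_le_mul h10 h3 (by norm_num) (by positivity)

/-- For `b ≥ 23/5`: `e^{2b} ≥ 9885`, `e^{2b} ≥ 9885(1 + t + t²/2)` (`t = 2b − 46/5`), and the polynomial dominations
`7900b² ≤ 17.06e^{2b}`, `36000b ≤ 17.06e^{2b}`, `180(6.4b + 1.04)² ≤ 17.06e^{2b}`, `18000(2b + 1/100) ≤ 17.06e^{2b}` used by the later parts.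
[this track, ATTEMPT-21 §2; DODGER-STAGE2-PLAN] -/
theorem exp_two_mul_bounds_seven {b : ℝ} (hb : 23 / 5 ≤ b) :
    9885 ≤ Real.exp (2 * b) ∧ 9885 * (1 + (2 * b - 46 / 5) + (2 * b - 46 / 5) ^ 2 / 2) ≤ Real.exp (2 * b) ∧
      7900 * b ^ 2 ≤ 17.06 * Real.exp (2 * b) ∧ 36000 * b ≤ 17.06 * Real.exp (2 * b) ∧
      180 * (6.4 * b + 1.04) ^ 2 ≤ 17.06 * Real.exp (2 * b) ∧ 18000 * (2 * b + 1 / 100) ≤ 17.06 * Real.exp (2 * b) := by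
  have h92 := exp_nine_point_two_ge
  set t : ℝ := 2 * b - 46 / 5 with ht
  have ht0 : 0 ≤ t := by rw [ht]; linarith
  have hsplit : Real.exp (2 * b) = Real.exp (46 / 5) * Real.exp t := by rw [← Real.exp_add]; congr 1; rw [ht]; ring
  have hq : 1 + t + t ^ 2 / 2 ≤ Real.exp t := Real.quadratic_le_exp_of_nonneg ht0
  have hmain : 9885 * (1 + t + t ^ 2 / 2) ≤ Real.exp (2 * b) := by
    rw [hsplit]; exact mul_le_mul h92 hq (by positivity) (Real.exp_pos _).le
  have hb' : b = 23 / 5 + t / 2 := by rw [ht]; ring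
  refine ⟨by nlinarith only [hmain, ht0], hmain, ?_, ?_, ?_, ?_⟩
  · have : 7900 * b ^ 2 ≤ 17.06 * (9885 * (1 + t + t ^ 2 / 2)) := by rw [hb']; nlinarith only [ht0]
    linarith only [this, hmain]
  · have : 36000 * b ≤ 17.06 * (9885 * (1 + t + t ^ 2 / 2)) := by rw [hb']; nlinarith only [ht0]
    linarith only [this, hmain]
  · have : 180 * (6.4 * b + 1.04) ^ 2 ≤ 17.06 * (9885 * (1 + t + t ^ 2 / 2)) := by rw [hb']; nlinarith only [ht0]
    linarith only [this, hmain]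
  · have : 18000 * (2 * b + 1 / 100) ≤ 17.06 * (9885 * (1 + t + t ^ 2 / 2)) := by rw [hb']; nlinarith only [ht0]
    linarith only [this, hmain]

/-! ## Basic sizes -/

/-- `log 12 ≤ 2.52` (from `12 ≤ e^{2.52}`). [folklore] -/
theorem log_twelve_le : Real.log 12 ≤ 2.52 := by
  have h27 : (12 : ℝ) ≤ Real.exp 2.52 := by
    have e1 : Real.exp 2.52 = Real.exp 2 * Real.exp 0.52 := by rw [← Real.exp_add]; norm_num
    have h7 : (1.6552 : ℝ) ≤ Real.exp 0.52 := by
      have := Real.quadratic_le_exp_of_nonneg (show (0 : ℝ) ≤ 0.52 by norm_num); norm_num at this; linarith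
    have h2 := exp_numerics.2.1
    rw [e1]; nlinarith only [h2, h7, Real.exp_pos (0.52 : ℝ)]
  calc Real.log 12 ≤ Real.log (Real.exp 2.52) := Real.log_le_log (by norm_num) h27
    _ = 2.52 := Real.log_exp _

/-- For `b ≥ 23/5`: `e ≤ T₀`, `17.079e^{2b} ≤ T₀ ≤ 17.08e^{2b}`, `168800 ≤ T₀`, `2b + 1 ≤ log T₀ ≤ 2b + 3`,
`10 ≤ s₁(T₀) ≤ 0.2505b + 10.14` (the last from `log X ≤ log 12 + X/12 − 1`). [this track, ATTEMPT-21 §2; ATTEMPT-23 §7] -/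
theorem seven_horizon_sizes {b : ℝ} (hb : 23 / 5 ≤ b) :
    Real.exp 1 ≤ dodgerT₀ b ∧ 17.079 * Real.exp (2 * b) ≤ dodgerT₀ b ∧ dodgerT₀ b ≤ 17.08 * Real.exp (2 * b) ∧
      168800 ≤ dodgerT₀ b ∧ 2 * b + 1 ≤ Real.log (dodgerT₀ b) ∧ Real.log (dodgerT₀ b) ≤ 2 * b + 3 ∧
      10 ≤ (0.1038 * Real.log (dodgerT₀ b) + 0.2573 * Real.log (Real.log (dodgerT₀ b)) + 9.3675) ∧
      (0.1038 * Real.log (dodgerT₀ b) + 0.2573 * Real.log (Real.log (dodgerT₀ b)) + 9.3675) ≤ 0.2505 * b + 10.14 := by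
  have hπ3 : 3.141592 < π := Real.pi_gt_d6
  have hπ4 : π < 3.1416 := Real.pi_lt_d4
  have hegt := Real.exp_one_gt_d9
  have helt := Real.exp_one_lt_d9
  obtain ⟨he, -, -, -, -, -⟩ := exp_two_mul_bounds_seven hb
  set T₀ := dodgerT₀ b with hT₀
  have hTe : T₀ = 2 * π * Real.exp 1 * Real.exp (2 * b) := by
    rw [hT₀, dodgerT₀, Real.exp_add]; ring
  have hc1 : (17.079 : ℝ) ≤ 2 * π * Real.exp 1 := by nlinarith only [hπ3, hegt]
  have hc2 : 2 * π * Real.exp 1 ≤ 17.08 := by nlinarith only [hπ4, helt, hπ3, hegt]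
  have hlo : 17.079 * Real.exp (2 * b) ≤ T₀ := by rw [hTe]; exact mul_le_mul_of_nonneg_right hc1 (Real.exp_pos _).le
  have hhi : T₀ ≤ 17.08 * Real.exp (2 * b) := by rw [hTe]; exact mul_le_mul_of_nonneg_right hc2 (Real.exp_pos _).le
  have hT₀lo : 168800 ≤ T₀ := by linarith only [hlo, he]
  have hT₀e : Real.exp 1 ≤ T₀ := by linarith only [hT₀lo, helt]
  have hT₀pos : 0 < T₀ := lt_of_lt_of_le (Real.exp_pos 1) hT₀e
  have hlog : Real.log T₀ = Real.log (2 * π) + 1 + 2 * b := by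
    rw [hT₀, dodgerT₀, Real.log_mul (by positivity) (Real.exp_pos _).ne', Real.log_exp]; ring
  have hl2π0 : 0 ≤ Real.log (2 * π) := Real.log_nonneg (by linarith)
  have hl2π2 : Real.log (2 * π) ≤ 2 := by
    have h72 := exp_numerics.2.1
    have : 2 * π ≤ Real.exp 2 := by linarith
    calc Real.log (2 * π) ≤ Real.log (Real.exp 2) := Real.log_le_log (by positivity) this
      _ = 2 := Real.log_exp 2
  have hlogT₀ge : 2 * b + 1 ≤ Real.log T₀ := by rw [hlog]; linarith
  have hlogT₀le : Real.log T₀ ≤ 2 * b + 3 := by rw [hlog]; linarith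
  have hlogT₀1 : 1 ≤ Real.log T₀ := by linarith
  have hll0 : 0 ≤ Real.log (Real.log T₀) := Real.log_nonneg hlogT₀1
  -- `log log T₀ ≤ log 12 + (log T₀)/12 − 1 ≤ 1.52 + (2b+3)/12`
  have hll : Real.log (Real.log T₀) ≤ 1.52 + (2 * b + 3) / 12 := by
    have hX0 : 0 < Real.log T₀ := by linarith
    have h1 := Real.log_le_sub_one_of_pos (show (0:ℝ) < Real.log T₀ / 12 by positivity)
    rw [Real.log_div hX0.ne' (by norm_num)] at h1
    have h2 := log_twelve_le
    have h3 : Real.log T₀ / 12 ≤ (2 * b + 3) / 12 := div_le_div_of_nonneg_right hlogT₀le (by norm_num)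
    linarith
  refine ⟨hT₀e, hlo, hhi, hT₀lo, hlogT₀ge, hlogT₀le, by nlinarith only [hlogT₀ge, hll0, hb], ?_⟩
  nlinarith only [hlogT₀le, hll, hb]

/-- For `b ≥ 23/5`: the two clean-horizon side conditions `T₀ ≤ (11/10)T*` and `s + 1 ≤ (14/2π)log(T₀/14)`.
[this track, ATTEMPT-16 (Q1a)(Q1b); ATTEMPT-21 §2] -/
theorem seven_horizon_side_conditions {b : ℝ} (hb : 23 / 5 ≤ b) :
    dodgerT₀ b ≤ 11 / 10 * (dodgerT₀ b - 4 * π * ((0.1038 * Real.log (dodgerT₀ b) + 0.2573 * Real.log (Real.log (dodgerT₀ b)) + 9.3675) + 2)) ∧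
    (0.1038 * Real.log (dodgerT₀ b) + 0.2573 * Real.log (Real.log (dodgerT₀ b)) + 9.3675) + 1 ≤ 14 / (2 * π) * Real.log (dodgerT₀ b / 14) := by
  obtain ⟨hT₀e, hT₀ge, -, hT₀lo, -, -, hs9, hsb⟩ := seven_horizon_sizes hb
  obtain ⟨he, -, -, h36, -, -⟩ := exp_two_mul_bounds_seven hb
  have hπ3 : 3 < π := Real.pi_gt_three
  have hπ4 : π < 3.1416 := Real.pi_lt_d4
  set T₀ := dodgerT₀ b with hT₀
  set s := (0.1038 * Real.log (dodgerT₀ b) + 0.2573 * Real.log (Real.log (dodgerT₀ b)) + 9.3675) with hs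
  have hT₀pos : 0 < T₀ := lt_of_lt_of_le (Real.exp_pos 1) hT₀e
  constructor
  · -- `44π(s+2) ≤ T₀`
    have h1 : 4 * π * (s + 2) ≤ 12.5664 * (0.2505 * b + 12.14) := by
      have := mul_nonneg (by linarith only [hπ4] : (0:ℝ) ≤ 3.1416 - π) (by linarith only [hs9] : (0:ℝ) ≤ s + 2)
      nlinarith only [this, hsb, hπ3, hs9]
    nlinarith only [h1, hT₀ge, h36, he, hb]
  · have hlog : Real.log (T₀ / 14) = Real.log (2 * π) + 1 + 2 * b - Real.log 14 := by
      rw [Real.log_div hT₀pos.ne' (by norm_num), hT₀, dodgerT₀, Real.log_mul (by positivity) (Real.exp_pos _).ne', Real.log_exp]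
      ring
    have hl2π0 : 0 ≤ Real.log (2 * π) := Real.log_nonneg (by linarith)
    have hl14 : Real.log 14 ≤ 3 := by
      rw [show (14 : ℝ) = 2 * 7 by norm_num, Real.log_mul (by norm_num) (by norm_num)]
      have h2 : Real.log 2 < 0.6931471808 := Real.log_two_lt_d9
      have h7 : Real.log 7 ≤ 2 := by
        have := Real.log_le_sub_one_of_pos (show (0:ℝ) < 7 / Real.exp 2 by positivity)
        rw [Real.log_div (by norm_num) (Real.exp_pos 2).ne', Real.log_exp] at this
        have he : 7 / Real.exp 2 ≤ 1 := by
          rw [div_le_one (Real.exp_pos 2)]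
          linarith [exp_numerics.2.1]
        linarith
      linarith
    rw [hlog]
    have h14 : (2.2 : ℝ) ≤ 14 / (2 * π) := by rw [le_div_iff₀ (by positivity)]; linarith
    have hpos : 0 ≤ Real.log (2 * π) + 1 + 2 * b - Real.log 14 := by linarith
    calc s + 1 ≤ 2.2 * (Real.log (2 * π) + 1 + 2 * b - Real.log 14) := by nlinarith only [hsb, hl2π0, hl14, hb]
      _ ≤ 14 / (2 * π) * (Real.log (2 * π) + 1 + 2 * b - Real.log 14) := mul_le_mul_of_nonneg_right h14 hpos

/-- For `b ≥ 23/5`: the lattice index `k′` satisfies `T* − π/b ≤ πk′/b ≤ T*`, `3 ≤ πk′/b`, `2 ≤ k′`,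
`2 ≤ πk′/b − π(3s+5)/b`, `1 ≤ k′ − 3s − 5`, and `πk′/b ≤ T₀`. [this track, ATTEMPT-16 §1; ATTEMPT-21 §2] -/
theorem seven_horizon_index_bounds {b : ℝ} (hb : 23 / 5 ≤ b) :
    π * (dodgerKprime b) / b ≤ dodgerTstar b ∧
    dodgerTstar b - π / b ≤ π * (dodgerKprime b) / b ∧
    3 ≤ π * (dodgerKprime b) / b ∧ 2 ≤ dodgerKprime b ∧
    2 ≤ π * (dodgerKprime b) / b - π * (3 * (0.1038 * Real.log (dodgerT₀ b) + 0.2573 * Real.log (Real.log (dodgerT₀ b)) + 9.3675) + 5) / b ∧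
    1 ≤ (dodgerKprime b : ℝ) - 3 * (0.1038 * Real.log (dodgerT₀ b) + 0.2573 * Real.log (Real.log (dodgerT₀ b)) + 9.3675) - 5 ∧
    π * (dodgerKprime b) / b ≤ dodgerT₀ b := by
  obtain ⟨hT₀e, hT₀ge, -, hT₀lo, -, -, hs9, hsb⟩ := seven_horizon_sizes hb
  obtain ⟨he, -, -, h36, -, -⟩ := exp_two_mul_bounds_seven hb
  have hπ3 : 3 < π := Real.pi_gt_three
  have hπ4 : π < 3.1416 := Real.pi_lt_d4
  have hπ := Real.pi_pos
  have hb00 : 0 < b := by linarith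
  set T₀ := dodgerT₀ b with hT₀
  set s := (0.1038 * Real.log (dodgerT₀ b) + 0.2573 * Real.log (Real.log (dodgerT₀ b)) + 9.3675) with hs
  have hTs : dodgerTstar b = T₀ - 4 * π * (s + 2) := rfl
  set Ts := dodgerTstar b with hTsdef
  have h4πs : 4 * π * (s + 2) ≤ 12.5664 * (0.2505 * b + 12.14) := by
    have := mul_nonneg (by linarith only [hπ4] : (0:ℝ) ≤ 3.1416 - π) (by linarith only [hs9] : (0:ℝ) ≤ s + 2)
    nlinarith only [this, hsb, hπ3, hs9]
  have hTs0 : 17.06 * Real.exp (2 * b) ≤ Ts := by rw [hTs]; nlinarith only [h4πs, hT₀ge, h36, he, hb]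
  have hTsbig : 168600 ≤ Ts := by nlinarith only [hTs0, he]
  have hTspos : 0 < Ts := by linarith
  -- the floor
  have hx0 : 0 ≤ b * Ts / π := by positivity
  have hk1 : ((dodgerKprime b : ℕ) : ℝ) ≤ b * Ts / π := Nat.floor_le hx0
  have hk2 : b * Ts / π - 1 ≤ ((dodgerKprime b : ℕ) : ℝ) := by
    have := Nat.lt_floor_add_one (b * Ts / π); rw [dodgerKprime]; linarith
  have hA : π * (dodgerKprime b) / b ≤ Ts := by
    rw [div_le_iff₀ hb00]
    have := mul_le_mul_of_nonneg_left hk1 hπ.le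
    rw [mul_div_assoc', mul_comm π (b * Ts), mul_div_assoc, div_self hπ.ne', mul_one] at this
    linarith
  have hB : Ts - π / b ≤ π * (dodgerKprime b) / b := by
    rw [le_div_iff₀ hb00, sub_mul, div_mul_cancel₀ _ hb00.ne']
    have := mul_le_mul_of_nonneg_left hk2 hπ.le
    rw [mul_sub, mul_one, mul_div_assoc', mul_comm π (b * Ts), mul_div_assoc, div_self hπ.ne', mul_one] at this
    linarith
  have hπb : π / b ≤ 1 := by rw [div_le_one hb00]; linarith
  have hπsb : π * (3 * s + 5) / b ≤ 27 := by
    rw [div_le_iff₀ hb00]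
    have : π * (3 * s + 5) ≤ 3.1416 * (0.7515 * b + 35.42) := by
      have := mul_nonneg (by linarith only [hπ4] : (0:ℝ) ≤ 3.1416 - π) (by linarith only [hs9] : (0:ℝ) ≤ 3 * s + 5)
      nlinarith only [this, hsb, hπ3, hs9]
    nlinarith only [this, hb]
  have hkr : Ts - 1 ≤ ((dodgerKprime b : ℕ) : ℝ) := by
    have : b * Ts / π ≥ Ts := by
      rw [ge_iff_le, le_div_iff₀ hπ]; nlinarith only [hb, hπ4, hTspos]
    linarith
  refine ⟨hA, hB, by linarith, ?_, by linarith, by nlinarith only [hkr, hsb, hTs0, h36, he, hb], ?_⟩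
  · have : (2 : ℝ) ≤ ((dodgerKprime b : ℕ) : ℝ) := by linarith
    exact_mod_cast this
  · have : Ts ≤ T₀ := by rw [hTs]; nlinarith only [hπ3, hs9]
    linarith

set_option maxHeartbeats 400000 in
/-- **Part (1) of the rate-7/100 discharge.** For every `b ≥ 23/5`: `T₀ ≤ 1.0011T′`, `T′ ≤ T₀`, `e^{2b} ≤ T′`, `168600 ≤ T′`,
`T′³/56.8 ≤ cI ≤ T′³`, `cI ≤ T′³/56.548`, `1024 ≤ 4cI`, `T′³/28.42 ≤ pL`, `0 < pU ≤ 0.3184·b·T′³`, `T′² ≤ W ≤ 1.0001T′²`, `W ≤ T′² + 1/4`,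
`2 ≤ k′ ≤ 0.3184·b·T′`, `k′ ≤ 0.31831·b·T′`, `17.06e^{2b} ≤ T′`, `7900b² ≤ T′`, `36000b ≤ T′`.
[this track, ATTEMPT-21 §2, ATTEMPT-23 §7; DODGER-STAGE2-PLAN] -/
theorem seven_horizon_sizes_B {b : ℝ} (hb : 23 / 5 ≤ b) :
    dodgerT₀ b ≤ 1.0011 * dodgerTprime b ∧ dodgerTprime b ≤ dodgerT₀ b ∧ Real.exp (2 * b) ≤ dodgerTprime b ∧
    168600 ≤ dodgerTprime b ∧
    dodgerTprime b ^ 3 / 56.8 ≤ dodgerCI b ∧ dodgerCI b ≤ dodgerTprime b ^ 3 ∧ dodgerCI b ≤ dodgerTprime b ^ 3 / 56.548 ∧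
    1024 ≤ 4 * dodgerCI b ∧
    dodgerTprime b ^ 3 / 28.42 ≤ dodgerPL b ∧
    0 < dodgerPU b ∧ dodgerPU b ≤ 0.3184 * b * dodgerTprime b ^ 3 ∧
    dodgerTprime b ^ 2 ≤ dodgerW b ∧ dodgerW b ≤ 1.0001 * dodgerTprime b ^ 2 ∧ dodgerW b ≤ dodgerTprime b ^ 2 + 1 / 4 ∧
    (2 : ℝ) ≤ (dodgerKprime b : ℝ) ∧ (dodgerKprime b : ℝ) ≤ 0.3184 * b * dodgerTprime b ∧
    (dodgerKprime b : ℝ) ≤ 0.31831 * b * dodgerTprime b ∧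
    17.06 * Real.exp (2 * b) ≤ dodgerTprime b ∧ 7900 * b ^ 2 ≤ dodgerTprime b ∧ 36000 * b ≤ dodgerTprime b := by
  obtain ⟨hT₀e, hT₀ge, hT₀le, hT₀lo, hlogT₀ge, hlogT₀, hs9, hsb⟩ := seven_horizon_sizes hb
  obtain ⟨he, -, h79, h36, -, -⟩ := exp_two_mul_bounds_seven hb
  obtain ⟨hA, hB, hT3, hk2, hℓ2, hK1, hAT₀⟩ := seven_horizon_index_bounds hb
  have hπ3 : 3 < π := Real.pi_gt_three
  have hπ4 : π < 3.1416 := Real.pi_lt_d4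
  have hπ6 : 3.141592 < π := Real.pi_gt_d6
  have hπ := Real.pi_pos
  have hb00 : 0 < b := by linarith
  set T₀ := dodgerT₀ b with hT₀
  set s := (0.1038 * Real.log (dodgerT₀ b) + 0.2573 * Real.log (Real.log (dodgerT₀ b)) + 9.3675 : ℝ) with hs
  have hTs : dodgerTstar b = T₀ - 4 * π * (s + 2) := rfl
  rw [hTs] at hA hB
  have hT'def : dodgerTprime b = π * (dodgerKprime b) / b := rfl
  set T' := dodgerTprime b with hT'
  rw [← hT'def] at hA hB hT3 hℓ2 hAT₀
  set k : ℝ := (dodgerKprime b : ℝ) with hk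
  have hπb : π / b ≤ 0.683 := by rw [div_le_iff₀ hb00]; nlinarith only [hπ4, hb]
  have h4πs : 4 * π * (s + 2) ≤ 12.5664 * (0.2505 * b + 12.14) := by
    have := mul_nonneg (by linarith only [hπ4] : (0:ℝ) ≤ 3.1416 - π) (by linarith only [hs9] : (0:ℝ) ≤ s + 2)
    nlinarith only [this, hsb, hπ3, hs9]
  -- `T′ ≥ T₀ − 4π(s+2) − π/b ≥ 17.079e^{2b} − (3.148b + 153.24) ≥ 17.06e^{2b}`
  have hT'lo : 17.079 * Real.exp (2 * b) - (3.15 * b + 153.3) ≤ T' := by linarith only [hB, hπb, h4πs, hT₀ge, hb]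
  have hT'17 : 17.06 * Real.exp (2 * b) ≤ T' := by nlinarith only [hT'lo, h36, he, hb]
  have hT'big : 168600 ≤ T' := by nlinarith only [hT'17, he]
  have hT'pos : 0 < T' := by linarith only [hT'big]
  have hexp2b : Real.exp (2 * b) ≤ T' := by nlinarith only [hT'17, he]
  have hT'79 : 7900 * b ^ 2 ≤ T' := h79.trans hT'17
  have hT'36 : 36000 * b ≤ T' := h36.trans hT'17
  -- `T₀ ≤ 1.0011 T′`
  have h101 : T₀ ≤ 1.0011 * T' := by nlinarith only [hB, hπb, h4πs, hT'17, h36, he, hb]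
  -- `k′ = bT′/π ≤ 0.31831 b T′`
  have hkT : k = b * T' / π := by rw [hT'def]; field_simp
  have hk04' : k ≤ 0.31831 * b * T' := by
    rw [hkT, div_le_iff₀ hπ]
    have := mul_nonneg hb00.le hT'pos.le
    nlinarith only [this, hπ6]
  have hk04 : k ≤ 0.3184 * b * T' := by nlinarith only [hk04', mul_nonneg hb00.le hT'pos.le]
  have hk0 : 0 ≤ k := by rw [hk]; exact Nat.cast_nonneg _
  -- `cI ≥ T′³/56.8`
  have hlogT₀0 : 0 ≤ Real.log T₀ := by linarith only [hlogT₀ge, hb00]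
  have hps : π * (3 * s + 5) / b + 1 ≤ 29 := by
    have : π * (3 * s + 5) / b ≤ 28 := by
      rw [div_le_iff₀ hb00]
      have h1 : π * (3 * s + 5) ≤ 3.1416 * (0.7515 * b + 35.42) := by
        have := mul_nonneg (by linarith only [hπ4] : (0:ℝ) ≤ 3.1416 - π) (by linarith only [hs9] : (0:ℝ) ≤ 3 * s + 5)
        nlinarith only [this, hsb, hπ3, hs9]
      nlinarith only [h1, hb]
    linarith only [this]
  have hps0 : 0 ≤ π * (3 * s + 5) / b + 1 := by
    have : 0 ≤ π * (3 * s + 5) / b := div_nonneg (by nlinarith only [hπ, hs9]) hb00.le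
    linarith only [this]
  -- `(T′ − a)³ ≥ T′³ − 3aT′²` for `0 ≤ a ≤ 29`
  have hcube : T' ^ 3 - 87 * T' ^ 2 ≤ (T' - π * (3 * s + 5) / b - 1) ^ 3 := by
    have e : T' - π * (3 * s + 5) / b - 1 = T' - (π * (3 * s + 5) / b + 1) := by ring
    rw [e]
    set a := π * (3 * s + 5) / b + 1 with ha
    have h1 : 0 ≤ (29 - a) * T' ^ 2 := mul_nonneg (by linarith only [hps]) (sq_nonneg _)
    have h2 : 0 ≤ a ^ 2 * (3 * T' - a) := mul_nonneg (sq_nonneg _) (by linarith only [hps, hT'big])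
    nlinarith only [h1, h2]
  have hsq : (s + 1) * (T' - 1) ^ 2 / 2 ≤ (0.12525 * b + 5.57) * T' ^ 2 := by
    have h2 : (T' - 1) ^ 2 ≤ T' ^ 2 := by nlinarith only [hT'big]
    have h3 : (s + 1) * (T' - 1) ^ 2 ≤ (0.2505 * b + 11.14) * T' ^ 2 :=
      mul_le_mul (by linarith only [hsb]) h2 (sq_nonneg _) (by linarith only [hb00])
    linarith only [h3]
  have hcI : T' ^ 3 / 56.8 ≤ dodgerCI b := by
    rw [dodgerCI, ← hT', ← hs, ← hT₀]
    have h4 : (Real.log T₀ + 1 / 3) / (6 * π) ≤ b := by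
      rw [div_le_iff₀ (by positivity)]; nlinarith only [hπ3, hlogT₀, hb]
    have h5 : (T' ^ 3 - 87 * T' ^ 2) / (18 * π) ≤ (T' - π * (3 * s + 5) / b - 1) ^ 3 / (18 * π) :=
      div_le_div_of_nonneg_right hcube (by positivity)
    have h6 : (T' ^ 3 - 87 * T' ^ 2) / 56.5488 ≤ (T' ^ 3 - 87 * T' ^ 2) / (18 * π) :=
      div_le_div_of_nonneg_left (by nlinarith only [hT'big]) (by positivity) (by nlinarith only [hπ4])
    have key : T' ^ 3 / 56.8 + b + (0.12525 * b + 5.57) * T' ^ 2 ≤ (T' ^ 3 - 87 * T' ^ 2) / 56.5488 := by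
      rw [div_add' _ _ _ (by norm_num), div_add' _ _ _ (by norm_num), div_le_div_iff₀ (by norm_num) (by norm_num)]
      have hT2 : 0 ≤ T' ^ 2 := sq_nonneg _
      have p1 : 36000 * b * T' ^ 2 ≤ T' ^ 3 := by nlinarith only [hT'36, hT2]
      have p2 : 168600 * T' ^ 2 ≤ T' ^ 3 := by nlinarith only [hT'big, hT2]
      have p2' : (1 : ℝ) ≤ T' ^ 2 := by nlinarith only [hT'big]
      have p3 : b ≤ b * T' ^ 2 := by nlinarith only [p2', hb00]
      nlinarith only [p1, p2, p3, hT2, hb00]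
    linarith only [key, h4, h5, h6, hsq]
  have hcI2 : dodgerCI b ≤ T' ^ 3 := by
    rw [dodgerCI, ← hT', ← hs, ← hT₀]
    have hc3 : (T' - π * (3 * s + 5) / b - 1) ^ 3 ≤ T' ^ 3 :=
      pow_le_pow_left₀ (by linarith only [hps, hT'big]) (by linarith only [hps0]) 3
    have h1 : (T' - π * (3 * s + 5) / b - 1) ^ 3 / (18 * π) ≤ T' ^ 3 / (18 * π) :=
      div_le_div_of_nonneg_right hc3 (by positivity)
    have h2 : T' ^ 3 / (18 * π) ≤ T' ^ 3 := by
      rw [div_le_iff₀ (by positivity)]; nlinarith only [pow_pos hT'pos 3, hπ3]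
    have hX : 0 ≤ (Real.log T₀ + 1 / 3) / (6 * π) := div_nonneg (by linarith only [hlogT₀0]) (by positivity)
    have hY : 0 ≤ (s + 1) * (T' - 1) ^ 2 / 2 :=
      div_nonneg (mul_nonneg (by linarith only [hs9]) (sq_nonneg _)) (by norm_num)
    linarith only [h1, h2, hX, hY]
  have hcI3 : dodgerCI b ≤ T' ^ 3 / 56.548 := by
    rw [dodgerCI, ← hT', ← hs, ← hT₀]
    have hc3 : (T' - π * (3 * s + 5) / b - 1) ^ 3 ≤ T' ^ 3 :=
      pow_le_pow_left₀ (by linarith only [hps, hT'big]) (by linarith only [hps0]) 3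
    have h1 : (T' - π * (3 * s + 5) / b - 1) ^ 3 / (18 * π) ≤ T' ^ 3 / (18 * π) :=
      div_le_div_of_nonneg_right hc3 (by positivity)
    have h2 : T' ^ 3 / (18 * π) ≤ T' ^ 3 / 56.548 :=
      div_le_div_of_nonneg_left (by positivity) (by norm_num) (by linarith only [hπ6])
    have hX : 0 ≤ (Real.log T₀ + 1 / 3) / (6 * π) := div_nonneg (by linarith only [hlogT₀0]) (by positivity)
    have hY : 0 ≤ (s + 1) * (T' - 1) ^ 2 / 2 :=
      div_nonneg (mul_nonneg (by linarith only [hs9]) (sq_nonneg _)) (by norm_num)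
    linarith only [h1, h2, hX, hY]
  have hcL : 1024 ≤ 4 * dodgerCI b := by
    have : T' ^ 3 / 56.8 ≥ 256 := by
      rw [ge_iff_le, le_div_iff₀ (by positivity)]
      nlinarith only [pow_le_pow_left₀ (by norm_num : (0:ℝ) ≤ 168600) hT'big 3]
    linarith only [this, hcI]
  have hpL : T' ^ 3 / 28.42 ≤ dodgerPL b := by
    rw [dodgerPL, ← hk]
    have h4 : k / 4 ≤ 0.0796 * (b * T') := by nlinarith only [hk04', mul_nonneg hb00.le hT'pos.le]
    have h3 : 2 * (T' ^ 3 / 56.8) - T' ^ 3 / 28.42 ≥ 0.0796 * (b * T') := by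
      have e : 2 * (T' ^ 3 / 56.8) - T' ^ 3 / 28.42 = T' ^ 3 * (2 / 56.8 - 1 / 28.42) := by ring
      rw [e, ge_iff_le]
      have q1 : b * T' ≤ T' ^ 2 / 36000 := by
        rw [le_div_iff₀ (by norm_num)]; nlinarith only [hT'36, hT'pos]
      have q2 : T' ^ 2 / 36000 ≤ T' ^ 3 * (1 / 3300000) := by
        rw [div_le_iff₀ (by norm_num)]; nlinarith only [hT'big, sq_nonneg T']
      nlinarith only [q1, q2, pow_pos hT'pos 3]
    linarith only [h3, h4, hcI]
  have hW : dodgerW b ≤ 1.0001 * T' ^ 2 := by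
    rw [dodgerW, ← hT']; nlinarith only [hT'big]
  have hW1 : T' ^ 2 ≤ dodgerW b := by rw [dodgerW, ← hT']; linarith only []
  have hW3 : dodgerW b ≤ T' ^ 2 + 1 / 4 := by rw [dodgerW, ← hT']
  have hk2' : (2 : ℝ) ≤ k := by rw [hk]; exact_mod_cast hk2
  have hpU : dodgerPU b ≤ 0.3184 * b * T' ^ 3 := by
    rw [dodgerPU, ← hk]
    have hW0 : 0 ≤ dodgerW b := by rw [dodgerW]; positivity
    have e1 : 0.31831 * b * T' * (T' ^ 2 + 1 / 4) = 0.31831 * (b * T') * T' ^ 2 + 0.0795775 * (b * T') := by ring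
    have hT2 : (885 : ℝ) ≤ T' ^ 2 := by nlinarith only [hT'big]
    have e2 : 0.0795775 * (b * T') ≤ 0.00009 * (b * T') * T' ^ 2 := by
      nlinarith only [mul_nonneg hb00.le hT'pos.le, hT2]
    have e3 : 0.3184 * b * T' ^ 3 = 0.3184 * (b * T') * T' ^ 2 := by ring
    calc k * dodgerW b ≤ 0.31831 * b * T' * (T' ^ 2 + 1 / 4) := mul_le_mul hk04' hW3 hW0 (by positivity)
      _ ≤ 0.3184 * b * T' ^ 3 := by rw [e1, e3]; linarith only [e2]
  have hpU0 : 0 < dodgerPU b := by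
    rw [dodgerPU, ← hk]; exact mul_pos (by linarith only [hk2']) (by rw [dodgerW]; positivity)
  exact ⟨h101, hAT₀, hexp2b, hT'big, hcI, hcI2, hcI3, hcL, hpL, hpU0, hpU, hW1, hW, hW3, hk2', hk04, hk04', hT'17, hT'79, hT'36⟩

end Summit.RiemannHypothesis.RiemannHypothesis.Theorems.Handoff

end
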